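import Literature.NumberTheory.EllipticCurves.IwasawaAlgebra
import Mathlib.RingTheory.PowerSeries.Inverse
import Mathlib.NumberTheory.Padics.PadicIntegers
import HarnessLib

/-!
# `(1+T)^{p^t} − 1` is `T^{p^t}` times a unit modulo Howard's Eisenstein polynomial `q_m = T^m + p`

Topic `NumberTheory/EllipticCurves`. THEOREMS ONLY (no `def`, no named fact, no instance, no `sorry`).

Let `Λ = ℤ_p⟦T⟧` (`IwasawaAlgebra p`) and `q_m = T^m + p` (`m ≥ 1`), so that `S_m = Λ/(q_m) = ℤ_p[π]`,
`π^m = −p`, is a totally ramified discrete valuation ring with uniformiser `π` = the image of `T` — the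
specialisations at which Howard reads off the `μ`-part of his Theorem B (How04, proof of Thm. 2.2.10, case
`𝔓 = pΛ`: "taking `𝔮 = T^m + p`"). The topological generator `γ` of `Γ = Gal(K_∞/K)` acts on `S_m` through
`γ ↦ 1 + T`, and an element of the decomposition group of a prime above `p` (of index `p^t` in `Γ`) through
`(1 + T)^{p^t}`. The `m`-UNIFORMITY of every local error term of the control theorem at `𝔮 = q_m` (How04
Lemma 3.2.7 / Prop. 3.2.8 run at the Eisenstein primes; crux card `specialise-first-mu-x10b`, supplement S1)
rests on the valuation computation

  `v_π((1 + π)^{p^t} − 1) = p^t`  for `m ≥ p^t`,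

i.e. `(1+T)^{p^t} − 1 ≡ T^{p^t} · (unit) (mod q_m)`: then multiplication by `(1+π)^{p^t} − 1` on any
`S_m`-module has the same kernel and cokernel as multiplication by `π^{p^t}`, whose sizes on `S_m/p^a`
(`= p^{p^t}`) do not depend on `m`. This file proves that congruence
(`exists_isUnit_onePlusX_pow_sub_one_eq_X_pow_mul`, `associated_onePlusX_pow_sub_one_X_pow`) from the
polynomial identity `(1+X)^{p^t} = 1 + X^{p^t} + p·X·Q(X)` (`p ∣ binom(p^t, j)` for `0 < j < p^t`,
`Nat.Prime.dvd_choose_pow`) and `p ≡ −T^m (mod q_m)` with `m + 1 > p^t`. Cell `pub/bsd-print-x9`, seat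
`bsd-line-x9-p1-w2` (g3); pure commutative algebra, no arithmetic input.

References: B. Howard, *The Heegner point Kolyvagin system*, Compositio Math. 140 (2004), proof of
Thm. 2.2.10 (arXiv:1202.6340, p. 18: "The case `𝔭 = pΛ` … taking `𝔮 = T^m + p`"); L. Washington,
*Introduction to Cyclotomic Fields*, §7.1–7.2 and §13.2 (distinguished / Eisenstein polynomials in `Λ`);
J.-P. Serre, *Local Fields*, I §6 (Eisenstein extensions are totally ramified).
-/

noncomputable section

open scoped Classical
open Polynomial

namespace Literature.NumberTheory.EllipticCurves

namespace IwasawaAlgebra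

variable (p : ℕ) [Fact p.Prime]

/-! ## §1 The polynomial identity `(1+X)^{p^t} = 1 + X^{p^t} + p·X·Q` -/

/-- **`(1 + X)^{p^t} = 1 + X^{p^t} + p · X · Q(X)` in `ℤ_p[X]`**: every middle binomial coefficient
`binom(p^t, j)`, `0 < j < p^t`, is divisible by `p` (`Nat.Prime.dvd_choose_pow`), and the difference
`(1+X)^{p^t} − 1 − X^{p^t}` has no constant term. [cite: Washington1997, §7.1 (Lemma: p ∣ binom(p^n, j))] [folklore] -/
theorem exists_one_add_X_pow_prime_pow_eq (t : ℕ) :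
    ∃ Q : ℤ_[p][X], ((1 : ℤ_[p][X]) + X) ^ (p ^ t) = 1 + X ^ (p ^ t) + C (p : ℤ_[p]) * X * Q := by
  have hp : p.Prime := Fact.out
  set P : ℤ_[p][X] := (1 + X) ^ (p ^ t) - 1 - X ^ (p ^ t) with hP
  -- every coefficient of `P` is divisible by `p`
  have hcoeff : ∀ n : ℕ, (p : ℤ_[p]) ∣ P.coeff n := by
    intro n
    have hc : P.coeff n = ((p ^ t).choose n : ℤ_[p]) - (if n = 0 then 1 else 0) -
        (if n = p ^ t then 1 else 0) := by
      rw [hP, coeff_sub, coeff_sub, add_comm, coeff_X_add_one_pow, coeff_one, coeff_X_pow]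
    rw [hc]
    by_cases hn0 : n = 0
    · subst hn0
      by_cases ht : (0 : ℕ) = p ^ t
      · exact absurd ht.symm (pow_ne_zero t hp.ne_zero)
      · simp [ht]
    · by_cases hnp : n = p ^ t
      · subst hnp
        simp [hp.ne_zero]
      · simp only [hn0, hnp, if_false, sub_zero]
        exact_mod_cast Nat.cast_dvd_cast (hp.dvd_choose_pow hn0 hnp)
  obtain ⟨Q₀, hQ₀⟩ := (C_dvd_iff_dvd_coeff (p : ℤ_[p]) P).mpr hcoeff
  -- `Q₀` has no constant term
  have hQ₀0 : Q₀.coeff 0 = 0 := by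
    have h0 : P.coeff 0 = 0 := by
      rw [hP, coeff_sub, coeff_sub, add_comm, coeff_X_add_one_pow, coeff_one, coeff_X_pow]
      by_cases ht : (0 : ℕ) = p ^ t
      · exact absurd ht.symm (pow_ne_zero t hp.ne_zero)
      · simp [ht]
    have h0' : (p : ℤ_[p]) * Q₀.coeff 0 = 0 := by rw [← coeff_C_mul, ← hQ₀, h0]
    rcases mul_eq_zero.mp h0' with h | h
    · exact absurd h (by exact_mod_cast hp.ne_zero)
    · exact h
  obtain ⟨Q, hQ⟩ := X_dvd_iff.mpr hQ₀0
  refine ⟨Q, ?_⟩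
  have : ((1 : ℤ_[p][X]) + X) ^ (p ^ t) = 1 + X ^ (p ^ t) + P := by rw [hP]; ring
  rw [this, hQ₀, hQ, mul_assoc]

/-- The same identity in `Λ = ℤ_p⟦T⟧`. [cite: Washington1997, §7.1] [folklore] -/
theorem exists_one_add_X_pow_prime_pow_eq_powerSeries (t : ℕ) :
    ∃ Q : IwasawaAlgebra p, ((1 : IwasawaAlgebra p) + PowerSeries.X) ^ (p ^ t) =
      1 + PowerSeries.X ^ (p ^ t) + PowerSeries.C (p : ℤ_[p]) * PowerSeries.X * Q := by
  obtain ⟨Q, hQ⟩ := exists_one_add_X_pow_prime_pow_eq p t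
  refine ⟨(Q : PowerSeries ℤ_[p]), ?_⟩
  have h := congrArg (fun P : ℤ_[p][X] ↦ (P : PowerSeries ℤ_[p])) hQ
  simpa only [Polynomial.coe_pow, Polynomial.coe_add, Polynomial.coe_one, Polynomial.coe_X,
    Polynomial.coe_mul, Polynomial.coe_C] using h

/-! ## §2 Modulo `q_m = T^m + p`, `m ≥ p^t`: `(1+T)^{p^t} − 1 = T^{p^t} · unit` -/

/-- **`(1+T)^{p^t} − 1 ≡ T^{p^t} · w (mod T^m + p)` with `w` a unit, for `p^t ≤ m`** — the valuation identity
`v_π((1+π)^{p^t} − 1) = p^t` in the totally ramified ring `S_m = Λ/(T^m + p) = ℤ_p[π]`, `π^m = −p`, behind the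
`m`-uniform control at Howard's Eisenstein primes `q_m`: from §1, `(1+T)^{p^t} − 1 = T^{p^t} + p·T·Q`, and
`p ≡ −T^m`, so the error term is `−T^{m+1}·Q = T^{p^t} · (−T^{m+1−p^t} Q)` with `m + 1 − p^t ≥ 1`; the unit is
`w = 1 − T^{m+1−p^t} Q` (constant coefficient `1`). [cite: Howard2004HeegnerKolyvagin, proof of Thm. 2.2.10 (𝔮 = T^m + p)]
[cite: Washington1997, §7.2 and §13.2] -/
theorem exists_isUnit_onePlusX_pow_sub_one_eq_X_pow_mul {t m : ℕ} (hm : p ^ t ≤ m) :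
    ∃ w : IwasawaAlgebra p ⧸
        Ideal.span {(PowerSeries.X ^ m + PowerSeries.C (p : ℤ_[p]) : IwasawaAlgebra p)},
      IsUnit w ∧
      Ideal.Quotient.mk _ (((1 : IwasawaAlgebra p) + PowerSeries.X) ^ (p ^ t) - 1) =
        Ideal.Quotient.mk _ (PowerSeries.X ^ (p ^ t)) * w := by
  set I : Ideal (IwasawaAlgebra p) :=
    Ideal.span {(PowerSeries.X ^ m + PowerSeries.C (p : ℤ_[p]) : IwasawaAlgebra p)} with hI
  obtain ⟨Q, hQ⟩ := exists_one_add_X_pow_prime_pow_eq_powerSeries p t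
  -- the unit `w = 1 − T^{m+1−p^t} · Q`
  set u : IwasawaAlgebra p := 1 - PowerSeries.X ^ (m + 1 - p ^ t) * Q with hu
  have hunit : IsUnit u := by
    rw [PowerSeries.isUnit_iff_constantCoeff]
    have hk : m + 1 - p ^ t ≠ 0 := by omega
    simp [hu, hk]
  refine ⟨Ideal.Quotient.mk I u, hunit.map _, ?_⟩
  -- `p ≡ −T^m (mod I)`
  have hpX : Ideal.Quotient.mk I (PowerSeries.C (p : ℤ_[p])) = -Ideal.Quotient.mk I (PowerSeries.X ^ m) := by
    rw [eq_neg_iff_add_eq_zero, ← map_add, Ideal.Quotient.eq_zero_iff_mem, hI, add_comm]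
    exact Ideal.subset_span rfl
  have hsub : ((1 : IwasawaAlgebra p) + PowerSeries.X) ^ (p ^ t) - 1 =
      PowerSeries.X ^ (p ^ t) + PowerSeries.C (p : ℤ_[p]) * PowerSeries.X * Q := by
    rw [hQ]; ring
  have hXm : (PowerSeries.X : IwasawaAlgebra p) ^ m * PowerSeries.X =
      PowerSeries.X ^ (p ^ t) * PowerSeries.X ^ (m + 1 - p ^ t) := by
    rw [← pow_succ, ← pow_add]
    congr 1
    omega
  have key : Ideal.Quotient.mk I (PowerSeries.X ^ m) * Ideal.Quotient.mk I PowerSeries.X =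
      Ideal.Quotient.mk I (PowerSeries.X ^ (p ^ t)) * Ideal.Quotient.mk I (PowerSeries.X ^ (m + 1 - p ^ t)) := by
    rw [← map_mul, hXm, map_mul]
  have key' : -Ideal.Quotient.mk I (PowerSeries.X ^ m) * Ideal.Quotient.mk I PowerSeries.X * Ideal.Quotient.mk I Q =
      -(Ideal.Quotient.mk I (PowerSeries.X ^ (p ^ t)) * Ideal.Quotient.mk I (PowerSeries.X ^ (m + 1 - p ^ t)) *
        Ideal.Quotient.mk I Q) := by
    rw [← key]; ring
  rw [hsub, map_add, map_mul, map_mul, hpX, key', hu, map_sub, map_one, map_mul]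
  ring

/-- **`(1+T)^{p^t} − 1` and `T^{p^t}` are associated in `Λ/(T^m + p)` for `p^t ≤ m`** — hence multiplication by
either has the same kernel and the same image on every `Λ/(T^m + p)`-module (the local error modules at
`v ∣ p` of the control theorem at `q_m` have size independent of `m`).
[cite: Howard2004HeegnerKolyvagin, proof of Thm. 2.2.10 (𝔮 = T^m + p)] [cite: Washington1997, §13.2] -/
theorem associated_onePlusX_pow_sub_one_X_pow {t m : ℕ} (hm : p ^ t ≤ m) :
    Associated
      (Ideal.Quotient.mk
        (Ideal.span {(PowerSeries.X ^ m + PowerSeries.C (p : ℤ_[p]) : IwasawaAlgebra p)})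
        (((1 : IwasawaAlgebra p) + PowerSeries.X) ^ (p ^ t) - 1))
      (Ideal.Quotient.mk
        (Ideal.span {(PowerSeries.X ^ m + PowerSeries.C (p : ℤ_[p]) : IwasawaAlgebra p)})
        (PowerSeries.X ^ (p ^ t))) := by
  obtain ⟨w, hw, h⟩ := exists_isUnit_onePlusX_pow_sub_one_eq_X_pow_mul p hm
  obtain ⟨u, rfl⟩ := hw
  exact ⟨u⁻¹, by rw [h, mul_assoc, Units.mul_inv, mul_one]⟩

/-! ## §3 Consequence for modules: the `γ^{p^t}`-invariants are the `π^{p^t}`-torsion -/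

/-- Multiplication by `a · u`, `u` a unit, kills the same elements as multiplication by `a` (commutative ring);
private helper. [folklore] -/
private theorem torsionBy_mul_eq_of_isUnit {R : Type*} [CommRing R] {M : Type*} [AddCommGroup M] [Module R M]
    (a : R) {u : R} (hu : IsUnit u) :
    Submodule.torsionBy R M (a * u) = Submodule.torsionBy R M a := by
  obtain ⟨u, rfl⟩ := hu
  ext x
  simp only [Submodule.mem_torsionBy_iff]
  constructor
  · intro h
    have h' : (↑u⁻¹ : R) • ((a * ↑u) • x) = 0 := by rw [h, smul_zero]
    rwa [smul_smul, mul_comm a, ← mul_assoc, Units.inv_mul, one_mul] at h'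
  · intro h
    rw [mul_comm, mul_smul, h, smul_zero]

/-- **On every `Λ/(T^m + p)`-module (`p^t ≤ m`), the elements killed by `(1+T)^{p^t} − 1` — the invariants of
`γ^{p^t}`, e.g. of the decomposition group of index `p^t` at a prime above `p` — are exactly the elements killed
by `T^{p^t}`**; in particular their number on `S_m/p^a`-type modules does not depend on `m` (the `m`-uniform
local error terms at `v ∣ p` of the control theorem at Howard's `𝔮 = T^m + p`).
[cite: Howard2004HeegnerKolyvagin, Lemma 3.2.7 and proof of Thm. 2.2.10 (𝔮 = T^m + p)] [cite: Washington1997, §13.2] -/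
theorem torsionBy_onePlusX_pow_sub_one_eq_torsionBy_X_pow {t m : ℕ} (hm : p ^ t ≤ m)
    (M : Type*) [AddCommGroup M]
    [Module (IwasawaAlgebra p ⧸
      Ideal.span {(PowerSeries.X ^ m + PowerSeries.C (p : ℤ_[p]) : IwasawaAlgebra p)}) M] :
    Submodule.torsionBy _ M
        (Ideal.Quotient.mk
          (Ideal.span {(PowerSeries.X ^ m + PowerSeries.C (p : ℤ_[p]) : IwasawaAlgebra p)})
          (((1 : IwasawaAlgebra p) + PowerSeries.X) ^ (p ^ t) - 1)) =
      Submodule.torsionBy _ M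
        (Ideal.Quotient.mk
          (Ideal.span {(PowerSeries.X ^ m + PowerSeries.C (p : ℤ_[p]) : IwasawaAlgebra p)})
          (PowerSeries.X ^ (p ^ t))) := by
  obtain ⟨w, hw, h⟩ := exists_isUnit_onePlusX_pow_sub_one_eq_X_pow_mul p hm
  rw [h, torsionBy_mul_eq_of_isUnit _ hw]

/-! ## §4 (appended) The `m`-uniform error-term lemma: nilpotent-plus-`(γ^{p^t} − 1)` operators -/

/-- **Nilpotent-versus-scalar** (private helper; the card's lemma (L)): if `N` is an `S`-linear endomorphism with `N^n = 0`
and `ε ∈ S`, then `ker (N − ε) ⊆ F[ε^n]` (from `N x = ε x` get `0 = N^n x = ε^n x`). [folklore] -/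
private theorem ker_sub_smul_id_le_torsionBy {S F : Type*} [CommRing S] [AddCommGroup F] [Module S F]
    (N : F →ₗ[S] F) (n : ℕ) (hN : N ^ n = 0) (ε : S) :
    LinearMap.ker (N - ε • LinearMap.id) ≤ Submodule.torsionBy S F (ε ^ n) := by
  intro x hx
  rw [LinearMap.mem_ker, LinearMap.sub_apply, LinearMap.smul_apply, LinearMap.id_apply, sub_eq_zero] at hx
  have key : ∀ k : ℕ, (N ^ k) x = ε ^ k • x := by
    intro k
    induction k with
    | zero => simp
    | succ k ih =>
      rw [pow_succ', Module.End.mul_apply, ih, map_smul, hx, smul_smul, pow_succ', mul_comm]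
  have hn := key n
  rw [hN, LinearMap.zero_apply] at hn
  exact (Submodule.mem_torsionBy_iff _ _).2 hn.symm

/-- Generic form (private helper): if `e = x · w` with `w` a unit and `N^n = 0`, then `ker (N + e) ⊆ V[x^n]`. [folklore] -/
private theorem ker_add_smul_id_le_torsionBy_pow_of_eq_mul {S V : Type*} [CommRing S] [AddCommGroup V] [Module S V]
    (N : V →ₗ[S] V) {n : ℕ} (hN : N ^ n = 0) {e x w : S} (h : e = x * w) (hw : IsUnit w) :
    LinearMap.ker (N + e • LinearMap.id) ≤ Submodule.torsionBy S V (x ^ n) := by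
  have hker : LinearMap.ker (N + e • LinearMap.id) ≤ Submodule.torsionBy S V ((-e) ^ n) := by
    have := ker_sub_smul_id_le_torsionBy N n hN (-e)
    rwa [neg_smul, sub_neg_eq_add] at this
  refine hker.trans (le_of_eq ?_)
  have hunit : IsUnit ((-1 : S) ^ n * w ^ n) := (isUnit_one.neg.pow n).mul (hw.pow n)
  rw [h, show (-(x * w)) ^ n = x ^ n * ((-1) ^ n * w ^ n) by ring, torsionBy_mul_eq_of_isUnit _ hunit]

/-- **The `m`-UNIFORM local error bound at `v ∣ p` for Howard's `𝔮 = T^m + p`** (card `specialise-first-mu-x10b`,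
supplement S1 with lemma (L)): on a `Λ/(T^m + p)`-module `V` (`p^t ≤ m`), if `N` is a nilpotent endomorphism with
`N^n = 0` (in the application: `N = (φ − 1) ⊗ u` for the Frobenius `φ` of the finite residue extension acting on the
finite group `Ẽ(k_{∞,w})[p^∞]`, tensored with `S_m`), then every element killed by `N + ((1+T)^{p^t} − 1)` — i.e. every
invariant of an element of the decomposition group acting as `φ ⊗ ψ(γ^{p^t})` — is killed by `T^{p^t}` to the `n`: the
error module lies in `V[π^{n p^t}]`, whose size on `S_m/p^a`-modules of bounded rank does not depend on `m`.
[cite: Howard2004HeegnerKolyvagin, Lemma 3.2.7 and proof of Thm. 2.2.10 (𝔮 = T^m + p)] [cite: Washington1997, §13.2] -/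
theorem ker_add_onePlusX_pow_sub_one_le_torsionBy_X_pow {t m : ℕ} (hm : p ^ t ≤ m)
    {V : Type*} [AddCommGroup V]
    [Module (IwasawaAlgebra p ⧸
      Ideal.span {(PowerSeries.X ^ m + PowerSeries.C (p : ℤ_[p]) : IwasawaAlgebra p)}) V]
    (N : V →ₗ[IwasawaAlgebra p ⧸
      Ideal.span {(PowerSeries.X ^ m + PowerSeries.C (p : ℤ_[p]) : IwasawaAlgebra p)}] V)
    {n : ℕ} (hN : N ^ n = 0) :
    LinearMap.ker (N +
        (Ideal.Quotient.mk
          (Ideal.span {(PowerSeries.X ^ m + PowerSeries.C (p : ℤ_[p]) : IwasawaAlgebra p)})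
          (((1 : IwasawaAlgebra p) + PowerSeries.X) ^ (p ^ t) - 1)) • LinearMap.id) ≤
      Submodule.torsionBy _ V
        (Ideal.Quotient.mk
          (Ideal.span {(PowerSeries.X ^ m + PowerSeries.C (p : ℤ_[p]) : IwasawaAlgebra p)})
          (PowerSeries.X ^ (p ^ t)) ^ n) := by
  obtain ⟨w, hw, h⟩ := exists_isUnit_onePlusX_pow_sub_one_eq_X_pow_mul p hm
  exact ker_add_smul_id_le_torsionBy_pow_of_eq_mul N hN h hw

end IwasawaAlgebra

end Literature.NumberTheory.EllipticCurves

end
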